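import Literature.IUT.HodgeTheaters.PuncturedEllipticCoveringsCor12InertiaCentralOfCuspGalois
import Literature.IUT.HodgeTheaters.PuncturedEllipticCoveringsCuspsProofs
import Literature.AnabelianGeometry.AbsoluteAnabelian.FreeProSigmaCompletionBridge
import Mathlib.Tactic.Group
import HarnessLib

/-!
# [IUTchI] §1: a `GeomOrigin` record can be put in STANDARD POSITION with respect to `X̲ → X` — Nielsen moves on the
# free generators (proof-only; discharges the hypothesis (SP1) of abc-iut-L5-d4's shadow comparison, R45 brick B3)

Mochizuki, *Inter-universal Teichmüller theory I*, kurims manuscript (May 2020), §1 p. 37 ("`X̲ := C̲ ×_C X`", the cyclic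
covering `X̲ → X` of degree `l`; `Δ_X` of the once-punctured elliptic curve `X`) [cite: Mochizuki2012, IUTchI §1 p.37]
(D-0012 claim key; series status DISPUTED — nothing of the series is asserted here); [AbsTopI] Lemma 4.5 (i) p. 54 ("free
pro-`Σ`", the tree's `IsFreeProOn`) [cite: MochizukiAbsTopI2012, Lemma 4.5 (i) p.54].

PROOF-ONLY file (cell abc-iut, seat abc-iut-L5-t1 gen 11 = the `GeomOrigin` lineage; by-name input OFFERED to
abc-iut-L5-d4's R45 «COR12-MODL-LAWS-DERIVE@M_l», whose brick B3 `comap_shadow_eq_of_standardPosition`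
(`PuncturedEllipticProLModelShadowPosition.lean`) carries the standard-position hypothesis (SP1) «`b ∈ Π_C̲`»).
* §1 (generic, `Literature.AnabelianGeometry.AbsoluteAnabelian`): **Nielsen moves preserve `IsFreeProOn` on a pair** —
  `IsFreeProOn.pair_swap` (`(a,b) ↦ (b,a)`) and `IsFreeProOn.pair_mul_pow` (`(a,b) ↦ (a, b·aᵏ)`), by transporting the
  universal property (`f ↦ (f 1, f 0)`, resp. `f ↦ (f 0, f 1 · (f 0ᵏ)⁻¹)`); the commutator is unchanged:
  `[a, b·aᵏ] = [a, b]`, `⟨[b,a]⟩ = ⟨[a,b]⟩`.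
* §2 `GeomOrigin.not_gens_mem_piXbar_both` — the two free generators of `Δ_X` cannot BOTH lie in `Π_X̲` (else the closed
  subgroup `Δ_X ∩ Π_X̲` would contain the dense `⟨a,b⟩`, so `Δ_X ≤ Π_X̲` would fix every cusp — but `Δ_X·D_{ε⁰} = Π_X`
  (cusp rationality, abc-iut-w4-d051's `CuspGalois.aug_decomp_surjective`) acts transitively and `ε′ ≠ ε⁰`);
  **`GeomOrigin.exists_standardPosition (O) (C) (hl : D.l.Prime) (hcard : Nat.card D.Cusp = D.l)` — there is a record
  `O′ : D.GeomOrigin` with `O′.gens 1 ∈ Π_X̲` and `O′.gens 0 ∉ Π_X̲`** (if `a ∉ Π_X̲`: `Π_X/Π_X̲` has prime order `l`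
  (`CuspGalois.card_cusp`), so `b ≡ a^{−n}` and `(a, b·aⁿ)` works; if `a ∈ Π_X̲`: swap).  «`X̲` has `l` cusps» is
  [IUTchI] Def. 3.1 (d) at the genuine datum (abc-iut-L5-t2 `ThetaGeometry.PiXbar_relIndex` via `card_cusp`).

HONEST FRAMING: classical group theory over hypothesis/origin records asserted for no instance; no `def`, no instance, no
new `Prop` fact; nothing here bears on [IUTchIII] Cor. 3.12 or asserts that abc is proved or refuted.
-/

noncomputable section

/-! ### §1. Nielsen moves on a free pair -/

namespace Literature.AnabelianGeometry.AbsoluteAnabelian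

universe v

variable {G : Type v} [Group G] [TopologicalSpace G] {S : Set ℕ}

/-- **`IsFreeProOn` is preserved by swapping a free pair**: `(a, b) ↦ (b, a)`.
[cite: MochizukiAbsTopI2012, Lemma 4.5 (i) p.54] -/
theorem IsFreeProOn.pair_swap {a b : G} (h : IsFreeProOn G S ![a, b]) : IsFreeProOn G S ![b, a] := by
  refine ⟨h.1, fun K _ _ _ _ hK f => ?_⟩
  obtain ⟨φ, ⟨hφc, hφ⟩, huniq⟩ := h.2 K hK ![f 1, f 0]
  have hφa : φ a = f 1 := by simpa using hφ 0
  have hφb : φ b = f 0 := by simpa using hφ 1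
  refine ⟨φ, ⟨hφc, ?_⟩, ?_⟩
  · intro i
    fin_cases i
    · simpa using hφb
    · simpa using hφa
  · rintro ψ ⟨hψc, hψ⟩
    have hψb : ψ b = f 0 := by simpa using hψ 0
    have hψa : ψ a = f 1 := by simpa using hψ 1
    refine huniq ψ ⟨hψc, ?_⟩
    intro i
    fin_cases i
    · simpa using hψa
    · simpa using hψb

/-- **`IsFreeProOn` is preserved by the Nielsen move `(a, b) ↦ (a, b·aᵏ)`** (transport of the universal property along
`f ↦ (f 0, f 1 · (f 0 ^ k)⁻¹)`). [cite: MochizukiAbsTopI2012, Lemma 4.5 (i) p.54] -/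
theorem IsFreeProOn.pair_mul_pow {a b : G} (h : IsFreeProOn G S ![a, b]) (k : ℕ) :
    IsFreeProOn G S ![a, b * a ^ k] := by
  refine ⟨h.1, fun K _ _ _ _ hK f => ?_⟩
  obtain ⟨φ, ⟨hφc, hφ⟩, huniq⟩ := h.2 K hK ![f 0, f 1 * (f 0 ^ k)⁻¹]
  have hφa : φ a = f 0 := by simpa using hφ 0
  have hφb : φ b = f 1 * (f 0 ^ k)⁻¹ := by simpa using hφ 1
  refine ⟨φ, ⟨hφc, ?_⟩, ?_⟩
  · intro i
    fin_cases i
    · simpa using hφa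
    · show φ (b * a ^ k) = f 1
      rw [map_mul, map_pow, hφa, hφb, inv_mul_cancel_right]
  · rintro ψ ⟨hψc, hψ⟩
    have hψa : ψ a = f 0 := by simpa using hψ 0
    have hψb' : ψ (b * a ^ k) = f 1 := by simpa using hψ 1
    have hψb : ψ b = f 1 * (f 0 ^ k)⁻¹ := by
      rw [map_mul, map_pow, hψa] at hψb'
      exact eq_mul_inv_of_mul_eq hψb'
    refine huniq ψ ⟨hψc, ?_⟩
    intro i
    fin_cases i
    · simpa using hψa
    · simpa using hψb

end Literature.AnabelianGeometry.AbsoluteAnabelian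

/-! ### §2. Standard position of a `GeomOrigin` record -/

namespace Literature.IUT.HodgeTheaters

namespace PuncturedEllipticData

namespace GeomOrigin

open Literature.AnabelianGeometry.AbsoluteAnabelian

universe u

variable {D : PuncturedEllipticData.{u}}

/-- The family `gens : Fin 2 → Δ_X` of a record IS the pair `(gens 0, gens 1)`. ([IUTchI] §1 p.37)
[claim: Mochizuki2012, status: disputed] -/
theorem gens_eq_pair (O : D.GeomOrigin) : O.gens = ![O.gens 0, O.gens 1] := by
  ext i : 1
  fin_cases i <;> rfl

/-- **The two free generators of `Δ_X` do not both lie in `Π_X̲`**: otherwise `Δ_X ≤ Π_X̲` (density of `⟨a,b⟩`,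
closedness of `Π_X̲`), so `Π_X = Δ_X · D_{ε⁰} ≤ Π_X̲` would act trivially on the cusps of `X̲`, contradicting transitivity
(`ε′ ≠ ε⁰`). ([IUTchI] §1 p.37) [claim: Mochizuki2012, status: disputed] -/
theorem not_gens_mem_piXbar_both (O : D.GeomOrigin) (C : D.CuspGalois) :
    ¬ ((O.gens 0 : D.PiC) ∈ D.PiXbar ∧ (O.gens 1 : D.PiC) ∈ D.PiXbar) := by
  rintro ⟨h0, h1⟩
  have hΔc : IsClosed ((D.PiX ⊓ D.DeltaC : Subgroup D.PiC) : Set D.PiC) := D.isClosed_piX_inf_deltaC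
  haveI : CompactSpace ↥(D.PiX ⊓ D.DeltaC) := isCompact_iff_compactSpace.mp hΔc.isCompact
  -- the closed subgroup `Δ_X ∩ Π_X̲` of `Δ_X` contains the dense `⟨a, b⟩`, hence everything
  set T : Subgroup ↥(D.PiX ⊓ D.DeltaC) := D.PiXbar.comap (D.PiX ⊓ D.DeltaC).subtype with hT
  have hTc : IsClosed (T : Set ↥(D.PiX ⊓ D.DeltaC)) := by
    rw [hT, Subgroup.coe_comap, Subgroup.coe_subtype]
    exact ((D.PiX.isClosed_of_isOpen D.isOpen_piX).inter
      (D.PiCbar.isClosed_of_isOpen D.isOpen_piCbar)).preimage continuous_subtype_val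
  have hrange : (FreeGroup.lift O.gens).range ≤ T := by
    rw [FreeGroup.range_lift_eq_closure, Subgroup.closure_le]
    rintro _ ⟨i, rfl⟩
    fin_cases i
    · exact h0
    · exact h1
  have hall : ∀ g : ↥(D.PiX ⊓ D.DeltaC), (g : D.PiC) ∈ D.PiXbar := by
    intro g
    have hsub : closure (Set.range (FreeGroup.lift O.gens)) ⊆ (T : Set ↥(D.PiX ⊓ D.DeltaC)) :=
      hTc.closure_subset_iff.mpr (by rintro _ ⟨w, rfl⟩; exact hrange ⟨w, rfl⟩)
    have hg : g ∈ T := hsub (by rw [O.isFreeProOn.dense_range_lift.closure_eq]; exact Set.mem_univ _)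
    exact hg
  -- but `Π_X = Δ_X · D_{ε⁰}` moves `ε⁰` to `ε′`
  obtain ⟨g, hg, hgε⟩ := C.transitive D.ε0 D.ε1
  obtain ⟨d, hd⟩ := C.aug_decomp_surjective D.ε0 (D.E.aug g)
  have hdD : (d : D.PiC) ∈ D.decomp D.ε0 := d.2
  have hdXbar : (d : D.PiC) ∈ D.PiXbar := D.decomp_le D.ε0 hdD
  have hdX : (d : D.PiC) ∈ D.PiX := (Subgroup.mem_inf.mp hdXbar).1
  have hh : g * (d : D.PiC)⁻¹ ∈ D.PiX ⊓ D.DeltaC := by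
    refine Subgroup.mem_inf.mpr ⟨mul_mem hg (inv_mem hdX), ?_⟩
    change g * (d : D.PiC)⁻¹ ∈ D.E.geom
    rw [FundamentalExtension.mem_geom, map_mul, map_inv]
    have haug : D.E.aug (d : D.PiC) = D.E.aug g := hd
    rw [haug, mul_inv_cancel]
  have hgXbar : g ∈ D.PiXbar := by
    have h := mul_mem (hall ⟨g * (d : D.PiC)⁻¹, hh⟩) hdXbar
    rwa [inv_mul_cancel_right] at h
  have hfix := C.act_apply_eq_self_of_mem_PiXbar hgXbar D.ε0
  rw [hgε] at hfix
  exact D.ε1_ne_ε0 hfix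

/-- **STANDARD POSITION**: if `X̲` has `l` cusps (`l` prime), every `GeomOrigin` record of `D` can be replaced by one whose
second generator lies in `Π_X̲ = Π_X ∩ Π_C̲` and whose first generator does not — Nielsen moves `(a,b) ↦ (a, b·aⁿ)`
(`Π_X/Π_X̲` cyclic of prime order, generated by `a ∉ Π_X̲`) or `(a,b) ↦ (b,a)`, which keep `[a,b]` up to inversion, so
(c′) and (e) are untouched.  Discharges (SP1) of abc-iut-L5-d4's `comap_shadow_eq_of_standardPosition`.
([IUTchI] §1 p.37) [claim: Mochizuki2012, status: disputed] -/
theorem exists_standardPosition (O : D.GeomOrigin) (C : D.CuspGalois) (hl : D.l.Prime)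
    (hcard : Nat.card D.Cusp = D.l) :
    ∃ O' : D.GeomOrigin, (O'.gens 1 : D.PiC) ∈ D.PiXbar ∧ (O'.gens 0 : D.PiC) ∉ D.PiXbar := by
  classical
  have hfree : IsFreeProOn ↥(D.PiX ⊓ D.DeltaC) Set.univ ![O.gens 0, O.gens 1] := by
    rw [← O.gens_eq_pair]; exact O.isFreeProOn
  by_cases ha : (O.gens 0 : D.PiC) ∈ D.PiXbar
  · -- swap: `(b, a)`
    have hb : (O.gens 1 : D.PiC) ∉ D.PiXbar := fun hb => O.not_gens_mem_piXbar_both C ⟨ha, hb⟩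
    refine ⟨⟨![O.gens 1, O.gens 0], hfree.pair_swap, ?_, O.deltaC_le_closure_torsion⟩, ?_, ?_⟩
    · intro x
      obtain ⟨g, hg, hI⟩ := O.inertia_eq_conj_commutator x
      refine ⟨g, hg, ?_⟩
      rw [hI]
      have he : g * ((O.gens 0 : D.PiC) * (O.gens 1 : D.PiC) * (O.gens 0 : D.PiC)⁻¹ * (O.gens 1 : D.PiC)⁻¹) * g⁻¹ =
          (g * (((![O.gens 1, O.gens 0] : Fin 2 → ↥(D.PiX ⊓ D.DeltaC)) 0 : D.PiC) *
            ((![O.gens 1, O.gens 0] : Fin 2 → ↥(D.PiX ⊓ D.DeltaC)) 1 : D.PiC) *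
            (((![O.gens 1, O.gens 0] : Fin 2 → ↥(D.PiX ⊓ D.DeltaC)) 0 : D.PiC))⁻¹ *
            (((![O.gens 1, O.gens 0] : Fin 2 → ↥(D.PiX ⊓ D.DeltaC)) 1 : D.PiC))⁻¹) * g⁻¹)⁻¹ := by
        simp only [Matrix.cons_val_zero, Matrix.cons_val_one]
        group
      rw [he, Subgroup.zpowers_inv]
    · simpa using ha
    · simpa using hb
  · -- `Π_X/Π_X̲` has prime order `l`, so `b ≡ a^{-n}`: take `(a, b·aⁿ)`
    haveI hN : (D.PiXbar.subgroupOf D.PiX).Normal := C.normal_PiXbar_subgroupOf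
    have hcardQ : Nat.card (D.PiX ⧸ D.PiXbar.subgroupOf D.PiX) = D.l := by
      rw [← Subgroup.index_eq_card, ← Subgroup.relIndex, ← C.card_cusp, hcard]
    haveI : Fact D.l.Prime := ⟨hl⟩
    haveI : Finite (D.PiX ⧸ D.PiXbar.subgroupOf D.PiX) :=
      Nat.finite_of_card_ne_zero (by rw [hcardQ]; exact hl.ne_zero)
    set aX : D.PiX := ⟨(O.gens 0 : D.PiC), (O.gens 0).2.1⟩ with haX
    set bX : D.PiX := ⟨(O.gens 1 : D.PiC), (O.gens 1).2.1⟩ with hbX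
    have ha1 : (aX : D.PiX ⧸ D.PiXbar.subgroupOf D.PiX) ≠ 1 := by
      intro h
      rw [QuotientGroup.eq_one_iff, Subgroup.mem_subgroupOf] at h
      exact ha h
    have htop : Subgroup.zpowers (aX : D.PiX ⧸ D.PiXbar.subgroupOf D.PiX) = ⊤ :=
      zpowers_eq_top_of_prime_card hcardQ ha1
    have hmem : ((bX : D.PiX ⧸ D.PiXbar.subgroupOf D.PiX))⁻¹ ∈
        Submonoid.powers (aX : D.PiX ⧸ D.PiXbar.subgroupOf D.PiX) := by
      rw [(isOfFinOrder_of_finite _).mem_powers_iff_mem_zpowers, htop]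
      exact Subgroup.mem_top _
    obtain ⟨n, hn'⟩ := hmem
    have hn : (aX : D.PiX ⧸ D.PiXbar.subgroupOf D.PiX) ^ n = ((bX : D.PiX ⧸ D.PiXbar.subgroupOf D.PiX))⁻¹ := hn'
    have hbn : (O.gens 1 : D.PiC) * (O.gens 0 : D.PiC) ^ n ∈ D.PiXbar := by
      have h1 : ((bX * aX ^ n : D.PiX) : D.PiX ⧸ D.PiXbar.subgroupOf D.PiX) = 1 := by
        rw [QuotientGroup.mk_mul, QuotientGroup.mk_pow, hn, mul_inv_cancel]
      rw [QuotientGroup.eq_one_iff, Subgroup.mem_subgroupOf] at h1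
      simpa [haX, hbX] using h1
    refine ⟨⟨![O.gens 0, O.gens 1 * O.gens 0 ^ n], hfree.pair_mul_pow n, ?_, O.deltaC_le_closure_torsion⟩, ?_, ?_⟩
    · intro x
      obtain ⟨g, hg, hI⟩ := O.inertia_eq_conj_commutator x
      refine ⟨g, hg, ?_⟩
      rw [hI]
      have he : (O.gens 0 : D.PiC) * (O.gens 1 : D.PiC) * (O.gens 0 : D.PiC)⁻¹ * (O.gens 1 : D.PiC)⁻¹ =
          ((![O.gens 0, O.gens 1 * O.gens 0 ^ n] : Fin 2 → ↥(D.PiX ⊓ D.DeltaC)) 0 : D.PiC) *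
            ((![O.gens 0, O.gens 1 * O.gens 0 ^ n] : Fin 2 → ↥(D.PiX ⊓ D.DeltaC)) 1 : D.PiC) *
            (((![O.gens 0, O.gens 1 * O.gens 0 ^ n] : Fin 2 → ↥(D.PiX ⊓ D.DeltaC)) 0 : D.PiC))⁻¹ *
            (((![O.gens 0, O.gens 1 * O.gens 0 ^ n] : Fin 2 → ↥(D.PiX ⊓ D.DeltaC)) 1 : D.PiC))⁻¹ := by
        simp only [Matrix.cons_val_zero, Matrix.cons_val_one, Subgroup.coe_mul, Subgroup.coe_pow]
        group
      rw [he]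
    · simpa using hbn
    · simpa using ha

end GeomOrigin

end PuncturedEllipticData

end Literature.IUT.HodgeTheaters

end
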